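import Mathlib.Analysis.SpecialFunctions.Pow.Real
import Mathlib.Tactic.Linarith
import Mathlib.Tactic.Positivity
import Mathlib.Tactic.Ring
import Mathlib.Tactic.FieldSimp
import Summits.CriticalPhenomena.PercolationContinuityZ3.Theorems.PercNearOneGluingNoHeavyLowerTailAPLConjFUnionDense
import HarnessLib

/-!
# `NoHeavyLowerTail` (stmt-CriticalPhenomena-4575) — CONJECTURE F under apex piece-union: cell form of the dense mixed-leaning lemma

Support file (prover prim-ineq-gen-8 gen 35; `--supports stmt-CriticalPhenomena-4575`; memo
run/shared/lean/prim/prim-ineq-gen-8/FINDING-gen35-CONJF-UNION.md §6).  Pure real algebra: no definitions, no named facts, no sorries.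

`…APLConjFUnionDense.lean` proves the dense mixed-leaning union lemma in normalised gadget coordinates
(`conjF_c_union_mixed_dense_norm`).  This file gives the CELL form used by the forest induction (memo FINDING-gen34-CONJF.md §2):
for nonnegative cell vectors `u = (u0,uab,uac,ubc,u3)` (b-leaning, `uab+uac ≤ 2u0`, `F_c(u) ≥ 0`) and `v` (c-leaning,
`vab+vac ≤ 2v0`, Harris, APL-G, the Gladkov–Zimin inequality (5.1) `(e_v+vbc)S_v − vab² − vac² − (v0+vbc)T_v ≥ 0` and
`vbc ≤ vab+vac`) the apex piece-union `w` satisfies `F_c(w) ≥ 0`.  The GZ-consequence `GZ3` of the normalised lemma is the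
identity `(S−D)(D²−eD+e²) + 2uab·uac·S − (2D−e)(TD−eS) = D·GZ + D(e−ubc)ubc + 2uab·uac(ubc+u3)` (`ring`).
With `conjF_c_union_mixed` / `conjF_c_union_mixed_pp` (`vbc ≥ vab+vac`) and gen 34's `conjF_c_union_of_light`
(`uab+uac ≥ 2u0` or `vab+vac ≥ 2v0`) this covers every mixed-leaning pair of LEMMA U″. [folklore algebra]
-/

namespace Summit.CriticalPhenomena.PercolationContinuityZ3.Theorems

namespace APL

set_option maxHeartbeats 1600000 in
/-- **LEMMA U″ (dense mixed-leaning leaf) in cells.**  `u ≥ 0` b-leaning (`uac ≤ uab`) with `uab+uac ≤ 2u0` and `F_c(u) ≥ 0`;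
`v ≥ 0` c-leaning (`vab ≤ vac`) with `vab+vac ≤ 2v0`, Harris `e_vS_v ≤ T_vD_v`, APL-G `(T_vD_v − e_vS_v)² ≤ vab·vac·S_v²`,
GZ (5.1) at the apex and `vbc ≤ vab+vac`.  Then the apex piece-union `w` satisfies `F_c(w) ≥ 0`. [folklore] -/
theorem conjF_c_union_mixed_dense (u0 uab uac ubc u3 v0 vab vac vbc v3 : ℝ)
    (hu0 : 0 ≤ u0) (huab : 0 ≤ uab) (huac : 0 ≤ uac) (hubc : 0 ≤ ubc) (hu3 : 0 ≤ u3)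
    (hv0 : 0 ≤ v0) (hvab : 0 ≤ vab) (hvac : 0 ≤ vac) (hvbc : 0 ≤ vbc) (hv3 : 0 ≤ v3)
    (hub : uac ≤ uab) (hue : uab + uac ≤ 2*u0)
    (hFC : 0 ≤ 3*(uab+uac)*(u0+uab+uac+ubc+u3) - (u0+uab+uac)*(3*uab+uac+2*u3))
    (hvc : vab ≤ vac) (hve : vab + vac ≤ 2*v0)
    (hHv : (vab+vac)*(v0+vab+vac+vbc+v3) ≤ (vab+vac+v3)*(v0+vab+vac))
    (hGv : ((vab+vac+v3)*(v0+vab+vac) - (vab+vac)*(v0+vab+vac+vbc+v3))^2 ≤ vab*vac*(v0+vab+vac+vbc+v3)^2)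
    (hGZv : 0 ≤ (vab+vac+vbc)*(v0+vab+vac+vbc+v3) - vab^2 - vac^2 - (v0+vbc)*(vab+vac+v3))
    (hdense : vbc ≤ vab + vac) :
    0 ≤ 3*((u0*vab+uab*v0+uab*vab)+(u0*vac+uac*v0+uac*vac))*(u0*v0+(u0*vab+uab*v0+uab*vab)+(u0*vac+uac*v0+uac*vac)+(u0*vbc+ubc*v0+ubc*vbc)+(u3*(v0+vab+vac+vbc+v3)+(u0+uab+uac+ubc+u3)*v3-u3*v3+uab*(vac+vbc)+uac*(vab+vbc)+ubc*(vab+vac))) - (u0*v0+(u0*vab+uab*v0+uab*vab)+(u0*vac+uac*v0+uac*vac))*(3*(u0*vab+uab*v0+uab*vab)+(u0*vac+uac*v0+uac*vac)+2*(u3*(v0+vab+vac+vbc+v3)+(u0+uab+uac+ubc+u3)*v3-u3*v3+uab*(vac+vbc)+uac*(vab+vbc)+ubc*(vab+vac))) := by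
  -- the polynomial identity  F_c(w) = (D_uD_v − (uab vac + uac vab))·(S_uS_v + 2A_uA_v − N) − 3u0v0S_uS_v
  have poly : 3*((u0*vab+uab*v0+uab*vab)+(u0*vac+uac*v0+uac*vac))*(u0*v0+(u0*vab+uab*v0+uab*vab)+(u0*vac+uac*v0+uac*vac)+(u0*vbc+ubc*v0+ubc*vbc)+(u3*(v0+vab+vac+vbc+v3)+(u0+uab+uac+ubc+u3)*v3-u3*v3+uab*(vac+vbc)+uac*(vab+vbc)+ubc*(vab+vac))) - (u0*v0+(u0*vab+uab*v0+uab*vab)+(u0*vac+uac*v0+uac*vac))*(3*(u0*vab+uab*v0+uab*vab)+(u0*vac+uac*v0+uac*vac)+2*(u3*(v0+vab+vac+vbc+v3)+(u0+uab+uac+ubc+u3)*v3-u3*v3+uab*(vac+vbc)+uac*(vab+vbc)+ubc*(vab+vac)))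
      = ((u0+uab+uac)*(v0+vab+vac) - (uab*vac+uac*vab))
          * ((u0+uab+uac+ubc+u3)*(v0+vab+vac+vbc+v3) + 2*(u0+ubc)*(v0+vbc)
              - ((uab-uac)*((v0+vab+vac) - (vab+vac)/2) - (vac-vab)*((u0+uab+uac) - (uab+uac)/2)))
        - 3*u0*v0*(u0+uab+uac+ubc+u3)*(v0+vab+vac+vbc+v3) := by
    ring
  rw [poly]
  -- degenerate pieces
  rcases eq_or_lt_of_le (show 0 ≤ u0+uab+uac by positivity) with hDu | hDu
  · have e0 : u0 = 0 := by linarith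
    have e1 : uab = 0 := by linarith
    have e2 : uac = 0 := by linarith
    subst e0 e1 e2
    norm_num
  rcases eq_or_lt_of_le (show 0 ≤ v0+vab+vac by positivity) with hDv | hDv
  · have e0 : v0 = 0 := by linarith
    have e1 : vab = 0 := by linarith
    have e2 : vac = 0 := by linarith
    subst e0 e1 e2
    norm_num
  -- generic case: normalise and apply the gadget-coordinate lemma
  have hSu : 0 < u0+uab+uac+ubc+u3 := by linarith
  have hSv : 0 < v0+vab+vac+vbc+v3 := by linarith
  have hDu0 : u0+uab+uac ≠ 0 := ne_of_gt hDu
  have hDv0 : v0+vab+vac ≠ 0 := ne_of_gt hDv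
  have hSu0 : u0+uab+uac+ubc+u3 ≠ 0 := ne_of_gt hSu
  have hSv0 : v0+vab+vac+vbc+v3 ≠ 0 := ne_of_gt hSv
  have h_y : 0 ≤ uac/(u0+uab+uac) := div_nonneg huac hDu.le
  have h_yx : uac/(u0+uab+uac) ≤ uab/(u0+uab+uac) := div_le_div_of_nonneg_right hub hDu.le
  have h_Q : uab/(u0+uab+uac) + uac/(u0+uab+uac) ≤ 2/3 := by
    rw [← add_div, div_le_iff₀ hDu]; linarith
  have h_D : 0 ≤ (u0+uab+uac)/(u0+uab+uac+ubc+u3) := div_nonneg hDu.le hSu.le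
  have h_D1 : (u0+uab+uac)/(u0+uab+uac+ubc+u3) ≤ 1 := by
    rw [div_le_one hSu]; linarith
  have h_F : 2*((uab+uac+u3)/(u0+uab+uac+ubc+u3)) ≤ 3*(uab/(u0+uab+uac) + uac/(u0+uab+uac))
      - (u0+uab+uac)/(u0+uab+uac+ubc+u3) * (uab/(u0+uab+uac) - uac/(u0+uab+uac)) := by
    have e1 : 3*(uab/(u0+uab+uac) + uac/(u0+uab+uac))
        - (u0+uab+uac)/(u0+uab+uac+ubc+u3) * (uab/(u0+uab+uac) - uac/(u0+uab+uac))
        - 2*((uab+uac+u3)/(u0+uab+uac+ubc+u3))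
        = (3*(uab+uac)*(u0+uab+uac+ubc+u3) - (u0+uab+uac)*(3*uab+uac+2*u3)) / ((u0+uab+uac)*(u0+uab+uac+ubc+u3)) := by
      field_simp; ring
    have : 0 ≤ 3*(uab/(u0+uab+uac) + uac/(u0+uab+uac))
        - (u0+uab+uac)/(u0+uab+uac+ubc+u3) * (uab/(u0+uab+uac) - uac/(u0+uab+uac))
        - 2*((uab+uac+u3)/(u0+uab+uac+ubc+u3)) := by
      rw [e1]; exact div_nonneg hFC (by positivity)
    linarith
  have h_x' : 0 ≤ vab/(v0+vab+vac) := div_nonneg hvab hDv.le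
  have h_xy' : vab/(v0+vab+vac) ≤ vac/(v0+vab+vac) := div_le_div_of_nonneg_right hvc hDv.le
  have h_Q' : vab/(v0+vab+vac) + vac/(v0+vab+vac) ≤ 2/3 := by
    rw [← add_div, div_le_iff₀ hDv]; linarith
  have h_D' : 0 ≤ (v0+vab+vac)/(v0+vab+vac+vbc+v3) := div_nonneg hDv.le hSv.le
  have h_D1' : (v0+vab+vac)/(v0+vab+vac+vbc+v3) ≤ 1 := by
    rw [div_le_one hSv]; linarith
  have h_l' : vab/(v0+vab+vac) + vac/(v0+vab+vac) ≤ (vab+vac+v3)/(v0+vab+vac+vbc+v3) := by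
    rw [← add_div, div_le_iff₀ hDv, div_mul_eq_mul_div, le_div_iff₀ hSv]; linarith
  have h_g' : ((vab+vac+v3)/(v0+vab+vac+vbc+v3) - vab/(v0+vab+vac) - vac/(v0+vab+vac))^2
      ≤ vab/(v0+vab+vac) * (vac/(v0+vab+vac)) := by
    have e1 : (vab+vac+v3)/(v0+vab+vac+vbc+v3) - vab/(v0+vab+vac) - vac/(v0+vab+vac)
        = ((vab+vac+v3)*(v0+vab+vac) - (vab+vac)*(v0+vab+vac+vbc+v3)) / ((v0+vab+vac+vbc+v3)*(v0+vab+vac)) := by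
      field_simp; ring
    have e2 : vab/(v0+vab+vac) * (vac/(v0+vab+vac))
        = (vab*vac*(v0+vab+vac+vbc+v3)^2) / ((v0+vab+vac+vbc+v3)*(v0+vab+vac))^2 := by
      field_simp
    rw [e1, e2, div_pow]
    exact div_le_div_of_nonneg_right hGv (by positivity)
  have h_V' : (v0+vab+vac)/(v0+vab+vac+vbc+v3) * (1 - (vab/(v0+vab+vac) + vac/(v0+vab+vac)))
      ≤ 1 - (vab+vac+v3)/(v0+vab+vac+vbc+v3) := by
    have e1 : 1 - (vab+vac+v3)/(v0+vab+vac+vbc+v3)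
        - (v0+vab+vac)/(v0+vab+vac+vbc+v3) * (1 - (vab/(v0+vab+vac) + vac/(v0+vab+vac)))
        = vbc/(v0+vab+vac+vbc+v3) := by
      field_simp; ring
    have : 0 ≤ 1 - (vab+vac+v3)/(v0+vab+vac+vbc+v3)
        - (v0+vab+vac)/(v0+vab+vac+vbc+v3) * (1 - (vab/(v0+vab+vac) + vac/(v0+vab+vac))) := by
      rw [e1]; exact div_nonneg hvbc hSv.le
    linarith
  -- GZ3 from GZ (5.1), density and nonnegativity
  have hts : 0 ≤ ((v0+vab+vac+vbc+v3) - (v0+vab+vac))*((v0+vab+vac)^2 - (vab+vac)*(v0+vab+vac) + (vab+vac)^2)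
      + 2*vab*vac*(v0+vab+vac+vbc+v3)
      - (2*(v0+vab+vac) - (vab+vac))*((vab+vac+v3)*(v0+vab+vac) - (vab+vac)*(v0+vab+vac+vbc+v3)) := by
    have e1 : ((v0+vab+vac+vbc+v3) - (v0+vab+vac))*((v0+vab+vac)^2 - (vab+vac)*(v0+vab+vac) + (vab+vac)^2)
        + 2*vab*vac*(v0+vab+vac+vbc+v3)
        - (2*(v0+vab+vac) - (vab+vac))*((vab+vac+v3)*(v0+vab+vac) - (vab+vac)*(v0+vab+vac+vbc+v3))
        = (v0+vab+vac)*((vab+vac+vbc)*(v0+vab+vac+vbc+v3) - vab^2 - vac^2 - (v0+vbc)*(vab+vac+v3))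
          + (v0+vab+vac)*((vab+vac-vbc)*vbc) + 2*(vab*vac)*(vbc+v3) := by
      ring
    rw [e1]
    have t1 : 0 ≤ (v0+vab+vac)*((vab+vac+vbc)*(v0+vab+vac+vbc+v3) - vab^2 - vac^2 - (v0+vbc)*(vab+vac+v3)) :=
      mul_nonneg hDv.le hGZv
    have t2 : 0 ≤ (v0+vab+vac)*((vab+vac-vbc)*vbc) := mul_nonneg hDv.le (mul_nonneg (by linarith) hvbc)
    have t3 : 0 ≤ 2*(vab*vac)*(vbc+v3) := by
      have := mul_nonneg (mul_nonneg hvab hvac) (add_nonneg hvbc hv3); linarith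
    linarith
  have h_G' : (2 - (vab/(v0+vab+vac) + vac/(v0+vab+vac))) * ((vab+vac+v3)/(v0+vab+vac+vbc+v3) - (vab/(v0+vab+vac) + vac/(v0+vab+vac)))
      ≤ (1 - (v0+vab+vac)/(v0+vab+vac+vbc+v3)) * (1 - (vab/(v0+vab+vac) + vac/(v0+vab+vac)) + (vab/(v0+vab+vac) + vac/(v0+vab+vac))^2)
        + 2*(vab/(v0+vab+vac))*(vac/(v0+vab+vac)) := by
    have e1 : (1 - (v0+vab+vac)/(v0+vab+vac+vbc+v3)) * (1 - (vab/(v0+vab+vac) + vac/(v0+vab+vac)) + (vab/(v0+vab+vac) + vac/(v0+vab+vac))^2)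
        + 2*(vab/(v0+vab+vac))*(vac/(v0+vab+vac))
        - (2 - (vab/(v0+vab+vac) + vac/(v0+vab+vac))) * ((vab+vac+v3)/(v0+vab+vac+vbc+v3) - (vab/(v0+vab+vac) + vac/(v0+vab+vac)))
        = (((v0+vab+vac+vbc+v3) - (v0+vab+vac))*((v0+vab+vac)^2 - (vab+vac)*(v0+vab+vac) + (vab+vac)^2)
            + 2*vab*vac*(v0+vab+vac+vbc+v3)
            - (2*(v0+vab+vac) - (vab+vac))*((vab+vac+v3)*(v0+vab+vac) - (vab+vac)*(v0+vab+vac+vbc+v3)))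
          / ((v0+vab+vac)^2*(v0+vab+vac+vbc+v3)) := by
      field_simp
    have : 0 ≤ (1 - (v0+vab+vac)/(v0+vab+vac+vbc+v3)) * (1 - (vab/(v0+vab+vac) + vac/(v0+vab+vac)) + (vab/(v0+vab+vac) + vac/(v0+vab+vac))^2)
        + 2*(vab/(v0+vab+vac))*(vac/(v0+vab+vac))
        - (2 - (vab/(v0+vab+vac) + vac/(v0+vab+vac))) * ((vab+vac+v3)/(v0+vab+vac+vbc+v3) - (vab/(v0+vab+vac) + vac/(v0+vab+vac))) := by
      rw [e1]; exact div_nonneg hts (by positivity)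
    linarith
  have key := conjF_c_union_mixed_dense_norm
    ((u0+uab+uac)/(u0+uab+uac+ubc+u3)) (uab/(u0+uab+uac)) (uac/(u0+uab+uac)) ((uab+uac+u3)/(u0+uab+uac+ubc+u3))
    ((v0+vab+vac)/(v0+vab+vac+vbc+v3)) (vab/(v0+vab+vac)) (vac/(v0+vab+vac)) ((vab+vac+v3)/(v0+vab+vac+vbc+v3))
    h_y h_yx h_Q h_D h_D1 h_F h_x' h_xy' h_Q' h_D' h_D1' h_l' h_g' h_V' h_G'
  -- bridge: the polynomial is (D_uD_vS_uS_v) · Φ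
  have bridge : ((u0+uab+uac)*(v0+vab+vac) - (uab*vac+uac*vab))
          * ((u0+uab+uac+ubc+u3)*(v0+vab+vac+vbc+v3) + 2*(u0+ubc)*(v0+vbc)
              - ((uab-uac)*((v0+vab+vac) - (vab+vac)/2) - (vac-vab)*((u0+uab+uac) - (uab+uac)/2)))
        - 3*u0*v0*(u0+uab+uac+ubc+u3)*(v0+vab+vac+vbc+v3)
      = ((u0+uab+uac)*(v0+vab+vac)*(u0+uab+uac+ubc+u3)*(v0+vab+vac+vbc+v3))
        * ((1 - (uab/(u0+uab+uac)*(vac/(v0+vab+vac)) + uac/(u0+uab+uac)*(vab/(v0+vab+vac))))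
            * (1 + 2*(1-(uab+uac+u3)/(u0+uab+uac+ubc+u3))*(1-(vab+vac+v3)/(v0+vab+vac+vbc+v3))
              - (u0+uab+uac)/(u0+uab+uac+ubc+u3)*((v0+vab+vac)/(v0+vab+vac+vbc+v3))
                *((uab/(u0+uab+uac)-uac/(u0+uab+uac))*(1-(vab/(v0+vab+vac)+vac/(v0+vab+vac))/2)
                  - (vac/(v0+vab+vac)-vab/(v0+vab+vac))*(1-(uab/(u0+uab+uac)+uac/(u0+uab+uac))/2)))
          - 3*(1-(uab/(u0+uab+uac)+uac/(u0+uab+uac)))*(1-(vab/(v0+vab+vac)+vac/(v0+vab+vac)))) := by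
    field_simp
    ring
  rw [bridge]
  exact mul_nonneg (by positivity) key

end APL

end Summit.CriticalPhenomena.PercolationContinuityZ3.Theorems
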